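import Literature.MathematicalPhysics.QuantumFieldTheory.Balaban1983to89.B15

/-!
# `Balaban1983to89.B15Eq06Resum` — [Balaban1989LargeFieldI] p. 176: (0.3) rewritten *"as a double sum over domains
# Z′, Z″"* and the exponentiated form (0.6) DERIVED from (0.3) and the polymer identity (0.5) (rows B15.Eq0.5 / B15.Eq0.6)

statement-level skeleton of published theorems with citation tags; proofs where landed; nothing here is a claim about
the Yang–Mills mass gap.

CITATION HEADER (lean-in-tree rule 2026-08-18).  T. Bałaban, *Large field renormalization. I. The basic step of the 𝐑
operation*, Commun. Math. Phys. **122**, 175–202 (1989), doi:10.1007/BF01257412, bib `Balaban1989LargeFieldI` (cell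
paper B15; PDF held `paper:balaban1989-cmp122-large-field-i`, journal page = PDF page + 174; p. 176 re-read AS AN IMAGE
on the x2 render `…/1989-cmp122-large-field-I/1989-cmp122-large-field-I-p002-x2.png`).  The paper is a manuscript UNDER
ADJUDICATION by the audit cell `pub-balaban`; nothing of it is asserted here: (0.5) enters as an explicit HYPOTHESIS
(`Hyp05`, the polymer expansion + exponentiation, whose construction is Sects. 1 ff. and [LF-II]) and (0.6) is PROVED
from it and from the definition (0.3) (`B15.Rop`, not restated).  Mega-formalization `lit-balaban`, reader/typer unit
`lit-balaban-r12` gen 5; rows `B15.Eq0.5`, `B15.Eq0.6` of `lit-balaban-r12/ROWS-B15.md` (both `typed-existing · shape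
only` via `B15.ExpForm06` before this file).

THE PRINTED TEXT (p. 176, verbatim).  *"(𝐑ρ)(V) = Σ_Z ρ(Z″, V) ∫dV⌈_{Z′}ρ(Z, V) / ∫dV⌈_{Z′}ρ(Z″, V). (0.3) … Consider
now the expression on the right-hand side of the definition. It can be written as a double sum over domains Z′, Z″,
Z′ ⊂ Z″ᶜ, and the summation over Z′ can be applied to the quotients. … Thus, we obtain the representation
Σ_{Z′⊂Z″ᶜ} ∫dV⌈_{Z′}ρ(Z′∪Z″, V) / ∫dV⌈_{Z′}ρ(Z″, V) = exp Σ_X 𝐑(X, V), (0.5) where the last sum is over X such, that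
X∩Z″ᶜ ≠ ∅. Using this representation, we rewrite the definition of the operation 𝐑: (𝐑ρ)(V) = Σ_{Z″} ρ(Z″, V) exp
Σ_X 𝐑(X, V). (0.6)"*

WHAT THIS FILE TYPES AND PROVES (over the abstract integration datum `B15.RData` of the b2b file `B15.lean`: regions
`Z : D.Reg`, the maps `Z ↦ Z′ = D.Zp Z`, `Z ↦ Z″ = D.Zpp Z`, restricted integrals `D.IntOver`, pieces `D.ρ`).
* `quotSum D W` — the left side of (0.5) for the region `Z″ = W`: the sum of the (0.3)-quotients over the regions `Z`
  with `Z″(Z) = W` (READING: the printed index *"Z′ ⊂ Z″ᶜ"* runs over the decompositions `Z = Z′ ∪ Z″` with second member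
  `W`; in the datum a region determines its decomposition, so the fibre `{Z : Z″(Z) = W}` IS that index set).
* `rop_eq_doubleSum` — *"It can be written as a double sum over domains Z′, Z″ … and the summation over Z′ can be applied
  to the quotients"*: `(𝐑ρ)(V) = Σ_W ρ(W, V) · quotSum W`, PROVED (`Finset.sum_fiberwise`).
* `Hyp05 D R` — (0.5) as a hypothesis: `quotSum W = exp (R W)` (`R W` ↤ `Σ_X 𝐑(X, V)`; in the datum the restricted
  integrals are numbers, so both sides are `V`-independent — DIVERGENCE of `B15.RData`, recorded, not repaired).
* `expForm06_of_hyp05` — **(0.6) PROVED from (0.3) + (0.5)**: `B15.ExpForm06 D D.Reg D.ρ (fun W _ => R W)`.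
HONEST SCOPE.  The content of (0.5) (localization, polymer expansion, exponentiation) is NOT touched; only the
resummation step of p. 176 is kernel-checked.
-/

noncomputable section

open scoped BigOperators

namespace Literature.MathematicalPhysics.QuantumFieldTheory.Balaban1983to89.B15Eq06Resum

open B15 (RData Rop ExpForm06)

variable (D : RData)

/-- The (0.3)-quotient of the region `Z`: `∫dV⌈_{Z′}ρ(Z, V) / ∫dV⌈_{Z′}ρ(Z″, V)`. [cite: Balaban1989LargeFieldI, (0.3) p.176] -/
def quot03 (Z : D.Reg) : ℝ := D.IntOver (D.Zp Z) (D.ρ Z) / D.IntOver (D.Zp Z) (D.ρ (D.Zpp Z))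

open Classical in
/-- The left side of **(0.5)** for the region `Z″ = W`: *"Σ_{Z′⊂Z″ᶜ} ∫dV⌈_{Z′}ρ(Z′∪Z″, V) / ∫dV⌈_{Z′}ρ(Z″, V)"* — the sum of the
quotients over the regions `Z` whose second member `Z″(Z)` is `W`. [cite: Balaban1989LargeFieldI, (0.5) p.176] -/
def quotSum (W : D.Reg) : ℝ := ∑ Z ∈ Finset.univ.filter (fun Z => D.Zpp Z = W), quot03 D Z

open Classical in
/-- **The double-sum form of (0.3)** (p. 176: *"It can be written as a double sum over domains Z′, Z″, Z′ ⊂ Z″ᶜ, and the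
summation over Z′ can be applied to the quotients"*): `(𝐑ρ)(V) = Σ_{Z″} ρ(Z″, V) · quotSum Z″`. [cite: Balaban1989LargeFieldI, (0.3) p.176] -/
theorem rop_eq_doubleSum (V : D.Vsp) : Rop D V = ∑ W : D.Reg, D.ρ W V * quotSum D W := by
  unfold Rop quotSum
  simp_rw [Finset.mul_sum]
  rw [← Finset.sum_fiberwise Finset.univ D.Zpp
    (fun Z => D.ρ (D.Zpp Z) V * (D.IntOver (D.Zp Z) (D.ρ Z) / D.IntOver (D.Zp Z) (D.ρ (D.Zpp Z))))]
  refine Finset.sum_congr rfl fun W _ => Finset.sum_congr rfl fun Z hZ => ?_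
  rw [Finset.mem_filter] at hZ
  rw [quot03, hZ.2]

/-- **(0.5)** p. 176 as a HYPOTHESIS on the datum: *"Σ_{Z′⊂Z″ᶜ} ∫dV⌈_{Z′}ρ(Z′∪Z″, V) / ∫dV⌈_{Z′}ρ(Z″, V) = exp Σ_X 𝐑(X, V),
(0.5) where the last sum is over X such, that X∩Z″ᶜ ≠ ∅"* — `R W` ↤ the exponent `Σ_X 𝐑(X, V)` attached to `Z″ = W`.
[cite: Balaban1989LargeFieldI, (0.5) p.176] -/
def Hyp05 (R : D.Reg → ℝ) : Prop := ∀ W : D.Reg, quotSum D W = Real.exp (R W)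

/-- **(0.6) DERIVED** (p. 176: *"Using this representation, we rewrite the definition of the operation 𝐑: (𝐑ρ)(V) =
Σ_{Z″} ρ(Z″, V) exp Σ_X 𝐑(X, V). (0.6)"*): the double-sum form of (0.3) and (0.5) give the typed shape `B15.ExpForm06`
with the index type of the regions `Z″`, the pieces `ρ(Z″, ·)` and the exponents `R`. [cite: Balaban1989LargeFieldI, (0.6) p.176] -/
theorem expForm06_of_hyp05 {R : D.Reg → ℝ} (h05 : Hyp05 D R) : ExpForm06 D D.Reg D.ρ (fun W _ => R W) := by
  intro V
  rw [rop_eq_doubleSum]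
  exact Finset.sum_congr rfl fun W _ => by rw [h05 W]

/-- Conversely, on the regions where `ρ(Z″, V) ≠ 0` for some `V`, the shape (0.6) with exponents `R` forces nothing new:
(0.6) is EQUIVALENT to (0.5) summed against the pieces — recorded as the identity `Σ_W ρ(W,V)(quotSum W − e^{R W}) = 0`.
[cite: Balaban1989LargeFieldI, (0.6) p.176] -/
theorem sum_mul_sub_eq_zero_of_expForm06 {R : D.Reg → ℝ} (h06 : ExpForm06 D D.Reg D.ρ (fun W _ => R W)) (V : D.Vsp) :
    ∑ W : D.Reg, D.ρ W V * (quotSum D W - Real.exp (R W)) = 0 := by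
  have h := h06 V
  rw [rop_eq_doubleSum] at h
  simp_rw [mul_sub, Finset.sum_sub_distrib, h, sub_self]

end Literature.MathematicalPhysics.QuantumFieldTheory.Balaban1983to89.B15Eq06Resum
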